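/-
Copyright: harness tree, Literature layer (sorry-free). b2b-lace num3-g12 (CERTIFIED NUMERICS SEAT 3 / ENUMERATION-HEAVY
LANE gen 12).  The `d = 11` record lines (Cert rev 7 and rev 10, App. D discharged) with the (S2b)-INIT binder `hIW` /
the twelve F-IM table hypotheses SUPPLIED by the kernel theorem `nobleWeightedDiagramBoundAt_bi7_discharged`
(`MeanFieldD11FimDischarged`).  Additive module: no record file is touched.  No `sorry`.
-/
import Literature.Probability.FitznerVanDerHofstad2017.MeanFieldD11AppDDischargedRev7
import Literature.Probability.FitznerVanDerHofstad2017.MeanFieldD11AppDDischargedRev10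
import Literature.Probability.FitznerVanDerHofstad2017.MeanFieldD11FimDischarged
import HarnessLib

/-!
# The `d = 11` record lines with (S2b)-INIT discharged in the kernel

`MeanFieldD11AppDDischargedRev7.meanField_full_d11_rev7_discharged_initTables` and
`MeanFieldD11AppDDischargedRev10.meanField_full_d11_rev10_discharged` display, besides the two ANALYTIC binders
(`hI43` = [NoBLE17] Assumption 4.3 at `p_I`; `hS` = Assumption 4.3 and [FvdH17] Prop. 2.2 on the window under `f ≤ Γ`),
the (S2b)-INIT binder `hIW : NobleWeightedDiagramBoundAt 11 (nbwThresholdI 11) bi7` — or, equivalently after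
`MeanFieldD11InitTables`, the twelve F-IM table hypotheses `hU20 … hL35`.  That binder is now the kernel theorem
`Stage1Cells.CertD11.nobleWeightedDiagramBoundAt_bi7_discharged` (`MeanFieldD11FimDischarged`: the tables decided on
the evaluator of `MeanFieldD11FimTables`, seeds by the SEEDCERT-Y certificates).  Hence:

* `meanField_full_d11_rev7_discharged_fim (hI43) (hS) : MeanField 11` and `percolationContinuity_d11_rev7_discharged_fim`
  — the rev-7 record line with exactly TWO binders left, both analytic;
* `meanField_full_d11_rev10_discharged_fim (hI43) (hS) : MeanField 11` and
  `percolationContinuity_d11_rev10_discharged_fim` — the same on the rev-10 line (`inputsI10/inputsO10`, `bo10`,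
  `cMuC8/cWeightsC8/GammaC8`).

No numeral of record is touched; no dimension other than the instantiated `d = 11`.

## References
* [FvdH17] R. Fitzner, R. van der Hofstad, Mean-field behavior for nearest-neighbor percolation in `d > 10`, EJP 22
  (2017) 43; arXiv:1506.07977 — Cor. 1.3 (d = 11), Prop. 2.2, §2.5, §5.2.
* [NoBLE17] R. Fitzner, R. van der Hofstad, PTRF 169 (2017) 1041–1119; arXiv:1506.07969 — Thm. 2.10, Prop. 2.11,
  Prop. 4.5, Prop. 1.1 step (b).
-/

set_option Elab.async false

noncomputable section

namespace Literature.Probability.FitznerVanDerHofstad2017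

open _root_.MeasureTheory Literature.Probability.LatticeModels
open Literature.Barriers.CriticalPhenomena Literature.Probability.Percolation

namespace D11

open D11FimSup Stage1Cells.CertD11

/-- **`MeanField 11` ON THE REV-7 RECORD LINE, App. D discharged AND (S2b)-INIT discharged in the kernel**: the binders
left are `hI43` ((S2a) at `p_I`, `inputsI7`) and `hS` ((S2a) ∧ (S2b)-IMPR on the window under `f ≤ Γ`), both analytic.
[cite: FitznerVanDerHofstad2017, Cor. 1.3 (d = 11); Prop. 2.2; §5.2] [cite: FitznerVanDerHofstad2016NoBLE, Thm. 2.10, Prop. 2.11, Prop. 4.5] -/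
theorem meanField_full_d11_rev7_discharged_fim
    (hI43 : NobleAssumption43At 11 (nbwThresholdI 11)
      (percolationNobleSplit 11 (nbwThresholdI 11) two_le_eleven (nbwThresholdI_lt_criticalProbI two_le_eleven)) inputsI7)
    (hS : ∀ (p : unitInterval) (hp : p ∈ Set.Ioo (nbwThresholdI 11) (criticalProbI 11)),
      (∀ j, Literature.Barriers.CriticalPhenomena.nobleF 11 cMuC cWeightsC j p ≤ GammaC j) →
        NobleAssumption43At 11 p (percolationNobleSplit 11 p two_le_eleven hp.2) inputsO7 ∧
        NobleWeightedDiagramBoundAt 11 p bo7) :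
    MeanField 11 :=
  meanField_full_d11_rev7_discharged hI43 nobleWeightedDiagramBoundAt_bi7_discharged hS

/-- `θ(p_c) = 0` on `ℤ^11` ON THE REV-7 RECORD LINE with App. D and (S2b)-INIT discharged (binders as in
`meanField_full_d11_rev7_discharged_fim`). [cite: FitznerVanDerHofstad2017, Cor. 1.3 (d = 11)] -/
theorem percolationContinuity_d11_rev7_discharged_fim
    (hI43 : NobleAssumption43At 11 (nbwThresholdI 11)
      (percolationNobleSplit 11 (nbwThresholdI 11) two_le_eleven (nbwThresholdI_lt_criticalProbI two_le_eleven)) inputsI7)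
    (hS : ∀ (p : unitInterval) (hp : p ∈ Set.Ioo (nbwThresholdI 11) (criticalProbI 11)),
      (∀ j, Literature.Barriers.CriticalPhenomena.nobleF 11 cMuC cWeightsC j p ≤ GammaC j) →
        NobleAssumption43At 11 p (percolationNobleSplit 11 p two_le_eleven hp.2) inputsO7 ∧
        NobleWeightedDiagramBoundAt 11 p bo7) :
    PercolationContinuity 11 :=
  (meanField_full_d11_rev7_discharged_fim hI43 hS).1

/-- **`MeanField 11` ON THE REV-10 LINE, App. D discharged AND (S2b)-INIT discharged in the kernel**: the binders left
are `hI43` ((S2a) at `p_I`, `inputsI10`) and `hS` ((S2a) ∧ (S2b)-IMPR on the window under `f ≤ Γ = GammaC8`, cells `bo10`).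
[cite: FitznerVanDerHofstad2017, Cor. 1.3 (d = 11); Prop. 2.2; §5.2] [cite: FitznerVanDerHofstad2016NoBLE, Thm. 2.10, Prop. 2.11, Prop. 4.5] -/
theorem meanField_full_d11_rev10_discharged_fim
    (hI43 : NobleAssumption43At 11 (nbwThresholdI 11)
      (percolationNobleSplit 11 (nbwThresholdI 11) two_le_eleven (nbwThresholdI_lt_criticalProbI two_le_eleven)) inputsI10)
    (hS : ∀ (p : unitInterval) (hp : p ∈ Set.Ioo (nbwThresholdI 11) (criticalProbI 11)),
      (∀ j, Literature.Barriers.CriticalPhenomena.nobleF 11 cMuC8 cWeightsC8 j p ≤ GammaC8 j) →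
        NobleAssumption43At 11 p (percolationNobleSplit 11 p two_le_eleven hp.2) inputsO10 ∧
        NobleWeightedDiagramBoundAt 11 p bo10) :
    MeanField 11 :=
  meanField_full_d11_rev10_discharged hI43 nobleWeightedDiagramBoundAt_bi7_discharged hS

/-- `θ(p_c) = 0` on `ℤ^11` ON THE REV-10 LINE with App. D and (S2b)-INIT discharged (binders as in
`meanField_full_d11_rev10_discharged_fim`). [cite: FitznerVanDerHofstad2017, Cor. 1.3 (d = 11)] -/
theorem percolationContinuity_d11_rev10_discharged_fim
    (hI43 : NobleAssumption43At 11 (nbwThresholdI 11)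
      (percolationNobleSplit 11 (nbwThresholdI 11) two_le_eleven (nbwThresholdI_lt_criticalProbI two_le_eleven)) inputsI10)
    (hS : ∀ (p : unitInterval) (hp : p ∈ Set.Ioo (nbwThresholdI 11) (criticalProbI 11)),
      (∀ j, Literature.Barriers.CriticalPhenomena.nobleF 11 cMuC8 cWeightsC8 j p ≤ GammaC8 j) →
        NobleAssumption43At 11 p (percolationNobleSplit 11 p two_le_eleven hp.2) inputsO10 ∧
        NobleWeightedDiagramBoundAt 11 p bo10) :
    PercolationContinuity 11 :=
  (meanField_full_d11_rev10_discharged_fim hI43 hS).1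

end D11

end Literature.Probability.FitznerVanDerHofstad2017

end
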